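import Literature.NumberTheory.DiophantineGeometry.PlaneCurveShearProofs
import Literature.NumberTheory.DiophantineGeometry.PlaneCurveFactorCountProofs
import Literature.NumberTheory.DiophantineGeometry.PlaneSectionBookkeepingProofs
import Literature.NumberTheory.DiophantineGeometry.PlaneCurveBezoutWeak
import Literature.NumberTheory.DiophantineGeometry.CafureMateraProofs
import HarnessLib

/-!
# Normalising a plane curve by a shear: total degree, top coefficient, good shears

Bookkeeping for the reduction of an arbitrary non-zero `P ∈ K[X][Y]` of total degree `e` (over a
finite field `K = 𝔽_q` with `q > 2e`) to the normal form of `PlaneCurvePointCountProofs` /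
`PlaneCurveFactorCountProofs` (monic in `Y` of degree `e = ` total degree, separable over `K(X)`):

* the weighted degree `max_k (deg_X a_k + k)` (the total degree of `P = ∑ a_k(X) Y^k`), written as
  the `Finset.sup` over the support: additive on products (`sup_support_mul`, `sup_support_prod`),
  `≥ 1` on irreducibles, so that `P` has at most `e` distinct irreducible factors
  (`card_normalizedFactors_toFinset_le_sup_support`);
* the sheared polynomial `P(X + cY, Y)` has total degree `≤ e` (`coeff_coeff_shear_eq_zero`) and
  `Y^e`-coefficient `T(c)` for the non-zero polynomial `T(Z) = ∑_k a_{k, e-k} Z^{e-k}` of degree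
  `≤ e` (`coeff_shear_eq_C`, `topForm_ne_zero`);
* for an irreducible `u`, `∂_Y u(X + cY, Y) = 0` for at most one `c` (chain rule and the `p`-th
  power lemma of `PlaneCurveShearProofs`), hence a **good shear** `c` exists when `q > 2e`: `T(c) ≠ 0`
  and every irreducible factor of `P` stays separable in `Y` (`exists_good_shear`);
* the trivial bound `#{P = 0} ≤ e q` (Cafure–Matera Lemma 2.1 for `n = 2`, transported from
  `MvPolynomial (Fin 2) K`).

No definitions, no new named facts.

## References

* A. Cafure, G. Matera, *Improved explicit estimates on the number of solutions of equations over
  a finite field*, Finite Fields Appl. 12 (2006) 155–185, Lemma 2.1, Lemma 5.1. [CafureMatera2006]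
-/

noncomputable section

open scoped Classical Polynomial.Bivariate
open Polynomial

namespace Literature.NumberTheory.DiophantineGeometry.PlaneShear

universe u v

/-- The shear `Φ(X, Y) ↦ Φ(X + cY, Y)` of `K[X][Y]` (local notation for the `aevalAeval` term). -/
local notation3 "sh[" K ", " c "]" =>
  (Polynomial.aevalAeval (R := K) (A := Polynomial (Polynomial K))
    (Polynomial.C Polynomial.X + Polynomial.C (Polynomial.C c) * Polynomial.X) Polynomial.X)

/-! ### The weighted degree `max_k (deg_X a_k + k)` as a `Finset.sup` -/

section WSup

variable {R : Type u} [CommRing R] [IsDomain R]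

omit [IsDomain R] in
/-- Each term is bounded by the weighted degree. [folklore] -/
theorem le_sup_support {P : R[X][Y]} {k : ℕ} (hk : P.coeff k ≠ 0) :
    (P.coeff k).natDegree + k ≤ P.support.sup fun k ↦ (P.coeff k).natDegree + k :=
  Finset.le_sup (f := fun k ↦ (P.coeff k).natDegree + k) (mem_support_iff.2 hk)

omit [IsDomain R] in
/-- The weighted degree is attained. [folklore] -/
theorem exists_eq_sup_support {P : R[X][Y]} (hP : P ≠ 0) :
    ∃ k, P.coeff k ≠ 0 ∧
      (P.coeff k).natDegree + k = P.support.sup fun k ↦ (P.coeff k).natDegree + k := by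
  have hne : P.support.Nonempty := by
    rw [Finset.nonempty_iff_ne_empty, Ne, support_eq_empty]; exact hP
  obtain ⟨k, hk, h⟩ := Finset.exists_mem_eq_sup P.support hne fun k ↦ (P.coeff k).natDegree + k
  exact ⟨k, mem_support_iff.1 hk, h.symm⟩

/-- **The weighted degree is additive on products.** [folklore] -/
theorem sup_support_mul {P Q : R[X][Y]} (hP : P ≠ 0) (hQ : Q ≠ 0) :
    ((P * Q).support.sup fun k ↦ ((P * Q).coeff k).natDegree + k) =
      (P.support.sup fun k ↦ (P.coeff k).natDegree + k) +
        Q.support.sup fun k ↦ (Q.coeff k).natDegree + k := by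
  apply le_antisymm
  · refine Finset.sup_le fun k hk ↦ ?_
    exact AlgFunctionField.natDegree_coeff_mul_add_le (fun k hk ↦ le_sup_support hk)
      (fun k hk ↦ le_sup_support hk) k (mem_support_iff.1 hk)
  · obtain ⟨k, hk0, hk⟩ := AlgFunctionField.exists_natDegree_coeff_mul_add_eq
      (fun k hk ↦ le_sup_support hk) (exists_eq_sup_support hP)
      (fun k hk ↦ le_sup_support hk) (exists_eq_sup_support hQ)
    rw [← hk]
    exact le_sup_support hk0

/-- The weighted degree is additive on finite products. [folklore] -/
theorem sup_support_prod {ι : Type v} (s : Finset ι) (f : ι → R[X][Y]) (hf : ∀ i ∈ s, f i ≠ 0) :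
    ((∏ i ∈ s, f i).support.sup fun k ↦ ((∏ i ∈ s, f i).coeff k).natDegree + k) =
      ∑ i ∈ s, (f i).support.sup fun k ↦ ((f i).coeff k).natDegree + k := by
  induction s using Finset.induction_on with
  | empty =>
    simp only [Finset.prod_empty, Finset.sum_empty]
    apply le_antisymm _ (Nat.zero_le _)
    refine Finset.sup_le fun k hk ↦ ?_
    rw [mem_support_iff, coeff_one] at hk
    split_ifs at hk with h
    · subst h; simp
    · exact absurd rfl hk
  | insert a s ha ih =>
    rw [Finset.prod_insert ha, Finset.sum_insert ha,
      sup_support_mul (hf a (Finset.mem_insert_self a s))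
        (Finset.prod_ne_zero_iff.2 fun i hi ↦ hf i (Finset.mem_insert_of_mem hi)),
      ih fun i hi ↦ hf i (Finset.mem_insert_of_mem hi)]

/-- The weighted degree is monotone under divisibility. [folklore] -/
theorem sup_support_le_of_dvd {u P : R[X][Y]} (h : u ∣ P) (hP : P ≠ 0) :
    (u.support.sup fun k ↦ (u.coeff k).natDegree + k) ≤
      P.support.sup fun k ↦ (P.coeff k).natDegree + k := by
  obtain ⟨v, rfl⟩ := h
  have hu : u ≠ 0 := fun h0 ↦ hP (by rw [h0, zero_mul])
  have hv : v ≠ 0 := fun h0 ↦ hP (by rw [h0, mul_zero])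
  rw [sup_support_mul hu hv]
  exact Nat.le_add_right _ _

omit [IsDomain R] in
/-- A polynomial of weighted degree `0` is a constant. [folklore] -/
theorem eq_C_C_of_sup_support_eq_zero {P : R[X][Y]}
    (h : (P.support.sup fun k ↦ (P.coeff k).natDegree + k) = 0) :
    P = C (C ((P.coeff 0).coeff 0)) := by
  have hk : ∀ k, P.coeff k ≠ 0 → k = 0 ∧ (P.coeff k).natDegree = 0 := fun k hk ↦ by
    have := le_sup_support hk; rw [h] at this; omega
  have h1 : P = C (P.coeff 0) := by
    refine Polynomial.ext fun k ↦ ?_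
    rw [coeff_C]
    split_ifs with hk0
    · rw [hk0]
    · by_contra hne
      exact hk0 (hk k hne).1
  have h2 : (P.coeff 0).natDegree = 0 := by
    by_cases h0 : P.coeff 0 = 0
    · rw [h0, natDegree_zero]
    · exact (hk 0 h0).2
  conv_lhs => rw [h1, eq_C_of_natDegree_eq_zero h2]

end WSup

section WSupField

variable {K : Type u} [Field K]

/-- An irreducible bivariate polynomial has weighted degree `≥ 1` (it is not a constant).
[folklore] -/
theorem one_le_sup_support_of_irreducible {u : K[X][Y]} (hu : Irreducible u) :
    1 ≤ u.support.sup fun k ↦ (u.coeff k).natDegree + k := by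
  by_contra h
  have h0 : (u.support.sup fun k ↦ (u.coeff k).natDegree + k) = 0 := by omega
  have hC := eq_C_C_of_sup_support_eq_zero h0
  by_cases ha : (u.coeff 0).coeff 0 = 0
  · exact hu.ne_zero (by rw [hC, ha, map_zero, map_zero])
  · exact hu.not_isUnit (by rw [hC]; exact isUnit_C.2 (isUnit_C.2 (IsUnit.mk0 _ ha)))

/-- **At most `deg P` distinct irreducible factors:** the number of distinct normalised irreducible
factors of `P ≠ 0` is at most its weighted (= total) degree. [folklore] -/
theorem card_normalizedFactors_toFinset_le_sup_support {P : K[X][Y]} (hP : P ≠ 0) :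
    (UniqueFactorizationMonoid.normalizedFactors P).toFinset.card ≤
      P.support.sup fun k ↦ (P.coeff k).natDegree + k := by
  set S := (UniqueFactorizationMonoid.normalizedFactors P).toFinset with hS
  have hmem : ∀ u ∈ S, u ∈ UniqueFactorizationMonoid.normalizedFactors P := fun u hu ↦
    Multiset.mem_toFinset.1 hu
  have hirr : ∀ u ∈ S, Irreducible u := fun u hu ↦
    UniqueFactorizationMonoid.irreducible_of_normalized_factor u (hmem u hu)
  have hne : ∀ u ∈ S, u ≠ 0 := fun u hu ↦ (hirr u hu).ne_zero
  have hdvd : ∏ u ∈ S, u ∣ P := by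
    have h1 : ∏ u ∈ S, u = (UniqueFactorizationMonoid.normalizedFactors P).dedup.prod := by
      rw [Finset.prod_eq_multiset_prod, hS, Multiset.toFinset_val, Multiset.map_id']
    rw [h1]
    exact dvd_trans (Multiset.prod_dvd_prod_of_le (Multiset.dedup_le _))
      (UniqueFactorizationMonoid.prod_normalizedFactors hP).dvd
  calc S.card = ∑ u ∈ S, 1 := Finset.card_eq_sum_ones S
    _ ≤ ∑ u ∈ S, u.support.sup fun k ↦ (u.coeff k).natDegree + k :=
        Finset.sum_le_sum fun u hu ↦ one_le_sup_support_of_irreducible (hirr u hu)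
    _ = (∏ u ∈ S, u).support.sup fun k ↦ ((∏ u ∈ S, u).coeff k).natDegree + k :=
        (sup_support_prod S id hne).symm
    _ ≤ P.support.sup fun k ↦ (P.coeff k).natDegree + k := sup_support_le_of_dvd hdvd hP

end WSupField

/-! ### Total degree of a sheared polynomial -/

section ShearDegree

variable {K : Type u} [CommRing K]

/-- Total degree of a power, in the `coeff`-`coeff` form of `PlaneSectionBookkeepingProofs`.
[folklore] -/
theorem coeff_coeff_pow_eq_zero {P : K[X][Y]} {d : ℕ}
    (hP : ∀ k j, d < j + k → (P.coeff k).coeff j = 0) (n : ℕ) :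
    ∀ k j, n * d < j + k → ((P ^ n).coeff k).coeff j = 0 := by
  induction n with
  | zero =>
    intro k j h
    rw [pow_zero]
    exact coeff_coeff_C_C_eq_zero (1 : K) k j (by omega)
  | succ n ih =>
    rw [pow_succ, Nat.succ_mul]
    exact coeff_coeff_mul_eq_zero ih hP

/-- Total degree of a finite sum. [folklore] -/
theorem coeff_coeff_sum_eq_zero {ι : Type v} (s : Finset ι) (f : ι → K[X][Y]) {d : ℕ}
    (hf : ∀ i ∈ s, ∀ k j, d < j + k → ((f i).coeff k).coeff j = 0) :
    ∀ k j, d < j + k → ((∑ i ∈ s, f i).coeff k).coeff j = 0 := by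
  intro k j h
  rw [finsetSum_coeff, finsetSum_coeff]
  exact Finset.sum_eq_zero fun i hi ↦ hf i hi k j h

/-- The substituted coefficient `a(X + cY)` has total degree `≤ deg a`. [folklore] -/
theorem coeff_coeff_aeval_shear_eq_zero (c : K) (a : K[X]) :
    ∀ k j, a.natDegree < j + k →
      ((aeval (C X + C (C c) * Y : K[X][Y]) a).coeff k).coeff j = 0 := by
  have hL : ∀ k j, 1 < j + k → ((C X + C (C c) * Y : K[X][Y]).coeff k).coeff j = 0 := by
    have := coeff_coeff_affine_eq_zero c (ℓ := (X : K[X])) natDegree_X_le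
    intro k j h
    rw [add_comm]
    exact this k j h
  rw [aeval_eq_sum_range]
  refine coeff_coeff_sum_eq_zero _ _ fun i hi ↦ ?_
  rw [Finset.mem_range] at hi
  have h1 := coeff_coeff_pow_eq_zero hL i
  rw [mul_one] at h1
  intro k j h
  rw [coeff_smul, coeff_smul, h1 k j (by omega), smul_zero]

/-- **The sheared polynomial has total degree at most the weighted degree:** if
`deg_X a_k + k ≤ e` for all `k` with `a_k ≠ 0`, then `P(X + cY, Y)` has no monomial `X^j Y^k` with
`j + k > e`. [folklore] -/
theorem coeff_coeff_shear_eq_zero (c : K) {P : K[X][Y]} {e : ℕ}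
    (hP : ∀ k, P.coeff k ≠ 0 → (P.coeff k).natDegree + k ≤ e) :
    ∀ k j, e < j + k → ((sh[K, c] P).coeff k).coeff j = 0 := by
  have hsum : sh[K, c] P = ∑ k ∈ P.support,
      aeval (C X + C (C c) * Y : K[X][Y]) (P.coeff k) * Y ^ k := by
    conv_lhs => rw [P.as_sum_support_C_mul_X_pow]
    rw [map_sum]
    refine Finset.sum_congr rfl fun k _ ↦ ?_
    rw [map_mul, map_pow, aevalAeval_C, aevalAeval_Y]
  rw [hsum]
  refine coeff_coeff_sum_eq_zero _ _ fun k hk ↦ ?_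
  have hk' := hP k (mem_support_iff.1 hk)
  intro k' j h
  rw [coeff_mul_X_pow']
  split_ifs with hkk
  · exact coeff_coeff_aeval_shear_eq_zero c (P.coeff k) (k' - k) j (by omega)
  · rw [coeff_zero]

/-- The coefficient of `Y^m` in `a(X + cY)` for `m ≥ deg a` is the constant `a_m c^m`.
[folklore] -/
theorem coeff_aeval_shear_of_natDegree_le (c : K) {a : K[X]} {m : ℕ} (hm : a.natDegree ≤ m) :
    (aeval (C X + C (C c) * Y : K[X][Y]) a).coeff m = C (a.coeff m * c ^ m) := by
  set L : K[X][Y] := C X + C (C c) * Y with hL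
  have hLdeg : L.natDegree ≤ 1 := by
    rw [hL, add_comm]
    exact natDegree_affine_le c X
  have hL1 : L.coeff 1 = C c := by
    rw [hL, add_comm]
    exact coeff_affine_one c X
  rw [aeval_eq_sum_range' (lt_of_le_of_lt hm (Nat.lt_succ_self m)), finsetSum_coeff,
    Finset.sum_range_succ, Finset.sum_eq_zero fun i hi ↦ ?_]
  · rw [zero_add, coeff_smul, show (L ^ m).coeff m = (L ^ m).coeff (m * 1) by rw [mul_one],
      coeff_pow_of_natDegree_le hLdeg, hL1, smul_eq_C_mul, ← C_pow, ← C_mul]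
  · rw [Finset.mem_range] at hi
    rw [coeff_smul, coeff_eq_zero_of_natDegree_lt (p := L ^ i), smul_zero]
    exact lt_of_le_of_lt natDegree_pow_le (by nlinarith)

/-- **The top `Y`-coefficient after a shear:** if `deg_X a_k + k ≤ e` for all `k` with `a_k ≠ 0`,
then the coefficient of `Y^e` in `P(X + cY, Y)` is the constant `T(c) = ∑_k a_{k, e-k} c^{e-k}`.
[folklore] -/
theorem coeff_shear_eq_C (c : K) {P : K[X][Y]} {e : ℕ}
    (hP : ∀ k, P.coeff k ≠ 0 → (P.coeff k).natDegree + k ≤ e) :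
    (sh[K, c] P).coeff e = C (∑ k ∈ P.support, (P.coeff k).coeff (e - k) * c ^ (e - k)) := by
  have hsum : sh[K, c] P = ∑ k ∈ P.support,
      aeval (C X + C (C c) * Y : K[X][Y]) (P.coeff k) * Y ^ k := by
    conv_lhs => rw [P.as_sum_support_C_mul_X_pow]
    rw [map_sum]
    refine Finset.sum_congr rfl fun k _ ↦ ?_
    rw [map_mul, map_pow, aevalAeval_C, aevalAeval_Y]
  rw [hsum, finsetSum_coeff, map_sum]
  refine Finset.sum_congr rfl fun k hk ↦ ?_
  have hk' := hP k (mem_support_iff.1 hk)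
  rw [coeff_mul_X_pow', if_pos (by omega),
    coeff_aeval_shear_of_natDegree_le c (by omega : (P.coeff k).natDegree ≤ e - k)]

/-- Evaluating the top form `T(Z) = ∑_k a_{k, e-k} Z^{e-k}`. [folklore] -/
theorem eval_topForm (c : K) (P : K[X][Y]) (e : ℕ) :
    (∑ k ∈ P.support, C ((P.coeff k).coeff (e - k)) * X ^ (e - k) : K[X]).eval c =
      ∑ k ∈ P.support, (P.coeff k).coeff (e - k) * c ^ (e - k) := by
  rw [eval_finsetSum]
  simp only [eval_mul, eval_C, eval_pow, eval_X]

/-- The top form has degree `≤ e`. [folklore] -/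
theorem natDegree_topForm_le (P : K[X][Y]) (e : ℕ) :
    (∑ k ∈ P.support, C ((P.coeff k).coeff (e - k)) * X ^ (e - k) : K[X]).natDegree ≤ e := by
  refine natDegree_sum_le_of_forall_le _ _ fun k _ ↦ ?_
  exact (natDegree_C_mul_X_pow_le _ _).trans (Nat.sub_le _ _)

/-- **The top form is non-zero** when `e` is the exact weighted degree. [folklore] -/
theorem topForm_ne_zero {P : K[X][Y]} {e : ℕ}
    (hP : ∀ k, P.coeff k ≠ 0 → (P.coeff k).natDegree + k ≤ e)
    (hatt : ∃ k, P.coeff k ≠ 0 ∧ (P.coeff k).natDegree + k = e) :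
    (∑ k ∈ P.support, C ((P.coeff k).coeff (e - k)) * X ^ (e - k) : K[X]) ≠ 0 := by
  obtain ⟨k₀, hk₀, hk₀e⟩ := hatt
  intro h0
  have h := congrArg (fun T : K[X] ↦ T.coeff (e - k₀)) h0
  simp only [finsetSum_coeff, coeff_C_mul_X_pow, coeff_zero] at h
  rw [Finset.sum_eq_single k₀ (fun k hk hne ↦ ?_) (fun h' ↦ absurd (mem_support_iff.2 hk₀) h')]
    at h
  · rw [if_pos rfl] at h
    have : (P.coeff k₀).coeff (e - k₀) = (P.coeff k₀).leadingCoeff := by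
      rw [leadingCoeff, show (P.coeff k₀).natDegree = e - k₀ by omega]
    rw [this, leadingCoeff_eq_zero] at h
    exact hk₀ h
  · have := hP k (mem_support_iff.1 hk)
    rw [if_neg (by omega)]

end ShearDegree

/-! ### Good shears -/

section GoodShear

variable {K : Type u} [Field K] [Fintype K]

/-- **For an irreducible `u`, the shear `u(X + cY, Y)` is inseparable in `Y` for at most one `c`:**
`∂_Y u(X + cY, Y) = (c ∂_X u + ∂_Y u)(X + cY, Y)` vanishes for two values of `c` only if
`∂_X u = ∂_Y u = 0`, i.e. (over the perfect field `K`) only if `u` is a `p`-th power. [folklore] -/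
theorem eq_of_derivative_shear_eq_zero {u : K[X][Y]} (hu : Irreducible u) {c₁ c₂ : K}
    (h₁ : derivative (sh[K, c₁] u) = 0) (h₂ : derivative (sh[K, c₂] u) = 0) : c₁ = c₂ := by
  -- the field `K` is perfect of prime characteristic `p`
  obtain ⟨p, hpchar⟩ := CharP.exists K
  haveI := hpchar
  haveI hprime : Fact p.Prime := ⟨CharP.char_is_prime K p⟩
  rw [derivative_shear, map_eq_zero_iff _ (shear_injective _)] at h₁ h₂
  by_contra hne
  have hX : Bivariate.swap (derivative (Bivariate.swap u)) = 0 := by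
    have h := sub_eq_zero.2 (h₁.trans h₂.symm)
    rw [add_sub_add_right_eq_sub, ← sub_mul, ← map_sub, ← map_sub] at h
    rcases mul_eq_zero.1 h with h' | h'
    · exact absurd h' (isUnit_C.2 (isUnit_C.2 (IsUnit.mk0 _ (sub_ne_zero.2 hne)))).ne_zero
    · exact h'
  have hX' : derivative (Bivariate.swap u) = 0 := by
    have := congrArg (Bivariate.swap (R := K)) hX
    rwa [Bivariate.swap_swap_apply, map_zero] at this
  rw [hX, mul_zero, zero_add] at h₁
  rcases derivative_ne_zero_or_of_irreducible p hu with h | h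
  · exact h hX'
  · exact h h₁

/-- **Existence of a good shear.** Let `P ≠ 0` have weighted degree exactly `e` with `2e < q`.
Then some `c ∈ K` has `T(c) ≠ 0` (the sheared polynomial keeps `Y`-degree `e` with constant top
coefficient) and `∂_Y u(X + cY, Y) ≠ 0` for every irreducible factor `u` of `P`: the first
condition excludes at most `e` values (roots of `T ≠ 0`, `deg T ≤ e`), the second at most one value
per factor, and there are at most `e` factors. [folklore] -/
theorem exists_good_shear {P : K[X][Y]} (hP0 : P ≠ 0) {e : ℕ}
    (hP : ∀ k, P.coeff k ≠ 0 → (P.coeff k).natDegree + k ≤ e)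
    (hatt : ∃ k, P.coeff k ≠ 0 ∧ (P.coeff k).natDegree + k = e) (hq : 2 * e < Fintype.card K) :
    ∃ c : K, (∑ k ∈ P.support, (P.coeff k).coeff (e - k) * c ^ (e - k)) ≠ 0 ∧
      ∀ u ∈ UniqueFactorizationMonoid.normalizedFactors P, derivative (sh[K, c] u) ≠ 0 := by
  set T : K[X] := ∑ k ∈ P.support, C ((P.coeff k).coeff (e - k)) * X ^ (e - k) with hT
  have hT0 : T ≠ 0 := topForm_ne_zero hP hatt
  set S := (UniqueFactorizationMonoid.normalizedFactors P).toFinset with hS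
  set bad₁ := (Finset.univ : Finset K).filter fun c ↦ T.eval c = 0 with hbad₁
  set bad₂ := S.biUnion fun u ↦ (Finset.univ : Finset K).filter
    fun c ↦ derivative (sh[K, c] u) = 0 with hbad₂
  have h₁ : bad₁.card ≤ e := by
    calc bad₁.card ≤ T.roots.toFinset.card := by
          refine Finset.card_le_card fun c hc ↦ ?_
          rw [Finset.mem_filter] at hc
          rw [Multiset.mem_toFinset, mem_roots hT0]
          exact hc.2
      _ ≤ T.natDegree := (Multiset.toFinset_card_le _).trans (card_roots' T)
      _ ≤ e := natDegree_topForm_le P e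
  have hsup : (P.support.sup fun k ↦ (P.coeff k).natDegree + k) = e := by
    apply le_antisymm (Finset.sup_le fun k hk ↦ hP k (mem_support_iff.1 hk))
    obtain ⟨k, hk, hke⟩ := hatt
    rw [← hke]
    exact le_sup_support hk
  have h₂ : bad₂.card ≤ e := by
    calc bad₂.card ≤ ∑ u ∈ S, ((Finset.univ : Finset K).filter
          fun c ↦ derivative (sh[K, c] u) = 0).card := Finset.card_biUnion_le
      _ ≤ ∑ u ∈ S, 1 := by
          refine Finset.sum_le_sum fun u hu ↦ Finset.card_le_one.2 fun c₁ h₁ c₂ h₂ ↦ ?_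
          rw [Finset.mem_filter] at h₁ h₂
          exact eq_of_derivative_shear_eq_zero
            (UniqueFactorizationMonoid.irreducible_of_normalized_factor u
              (Multiset.mem_toFinset.1 hu)) h₁.2 h₂.2
      _ = S.card := (Finset.card_eq_sum_ones S).symm
      _ ≤ e := by rw [← hsup]; exact card_normalizedFactors_toFinset_le_sup_support hP0
  have hlt : (bad₁ ∪ bad₂).card < (Finset.univ : Finset K).card := by
    rw [Finset.card_univ]
    exact lt_of_le_of_lt (Finset.card_union_le _ _) (by omega)
  obtain ⟨c, -, hc⟩ := Finset.exists_mem_notMem_of_card_lt_card hlt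
  rw [Finset.mem_union, not_or] at hc
  refine ⟨c, ?_, fun u hu ↦ ?_⟩
  · have h := hc.1
    rw [hbad₁, Finset.mem_filter, not_and] at h
    have := h (Finset.mem_univ c)
    rwa [hT, eval_topForm] at this
  · have h := hc.2
    rw [hbad₂, Finset.mem_biUnion, not_exists] at h
    have := h u
    rw [not_and] at this
    have := this (Multiset.mem_toFinset.2 hu)
    rw [Finset.mem_filter, not_and] at this
    exact this (Finset.mem_univ c)

end GoodShear

/-! ### The trivial bound `#{P = 0} ≤ (deg P) q` -/

section Trivial

variable {K : Type u} [Field K] [Fintype K]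

/-- The zeros of `P ∈ K[X][Y]` in `K²` are the rational points of the corresponding
`MvPolynomial (Fin 2) K` (through `Polynomial.Bivariate.equivMvPolynomial`). [folklore] -/
theorem card_filter_evalEval_eq_rationalPointCount (P : K[X][Y]) :
    (Finset.univ.filter fun p : K × K ↦ P.evalEval p.1 p.2 = 0).card =
      rationalPointCount (Bivariate.equivMvPolynomial K P) := by
  unfold rationalPointCount
  refine Finset.card_bij (fun p _ ↦ ![p.1, p.2]) (fun p hp ↦ ?_) (fun p₁ _ p₂ _ h ↦ ?_)
    (fun x hx ↦ ?_)
  · rw [Finset.mem_filter] at hp ⊢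
    refine ⟨Finset.mem_univ _, ?_⟩
    rw [Dioph.eval_equivMvPolynomial]
    exact hp.2
  · have h0 := congrFun h 0
    have h1 := congrFun h 1
    simp only [Matrix.cons_val_zero, Matrix.cons_val_one] at h0 h1
    exact Prod.ext h0 h1
  · refine ⟨(x 0, x 1), ?_, ?_⟩
    · rw [Finset.mem_filter] at hx ⊢
      refine ⟨Finset.mem_univ _, ?_⟩
      have hx' : x = ![x 0, x 1] := by ext i; fin_cases i <;> rfl
      rw [← Dioph.eval_equivMvPolynomial, ← hx']
      exact hx.2
    · ext i; fin_cases i <;> rfl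

omit [Fintype K] in
/-- The total degree of the corresponding `MvPolynomial (Fin 2) K` is read off from the
`coeff`-`coeff` bound. [folklore] -/
theorem totalDegree_equivMvPolynomial_le {P : K[X][Y]} {e : ℕ}
    (hP : ∀ k j, e < j + k → (P.coeff k).coeff j = 0) :
    (Bivariate.equivMvPolynomial K P).totalDegree ≤ e := by
  rw [MvPolynomial.totalDegree]
  refine Finset.sup_le fun s hs ↦ ?_
  have hs' : s = Finsupp.single 0 (s 0) + Finsupp.single 1 (s 1) := by
    ext i
    fin_cases i <;> simp
  rw [MvPolynomial.mem_support_iff, hs', Dioph.coeff_equivMvPolynomial] at hs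
  rw [hs', Dioph.sum_single_add_single]
  by_contra hlt
  exact hs (hP _ _ (by omega))

/-- **Cafure–Matera Lemma 2.1 for plane curves:** a non-zero `P ∈ K[X][Y]` with no monomial
`X^j Y^k` of degree `j + k > e` has at most `e q` zeros in `K²` (transported from
`rationalPointCount_le_totalDegree_mul` through `Polynomial.Bivariate.equivMvPolynomial`).
[cite: CafureMatera2006, Lemma 2.1] -/
theorem card_filter_evalEval_le_mul {P : K[X][Y]} (hP0 : P ≠ 0) {e : ℕ}
    (hP : ∀ k j, e < j + k → (P.coeff k).coeff j = 0) :
    (Finset.univ.filter fun p : K × K ↦ P.evalEval p.1 p.2 = 0).card ≤ e * Fintype.card K := by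
  have hF0 : Bivariate.equivMvPolynomial K P ≠ 0 := by
    rw [Ne, map_eq_zero_iff _ (Bivariate.equivMvPolynomial K).injective]
    exact hP0
  have hcount := rationalPointCount_le_totalDegree_mul hF0
  simp only [Nat.add_one_sub_one, pow_one] at hcount
  rw [card_filter_evalEval_eq_rationalPointCount]
  exact hcount.trans (Nat.mul_le_mul_right _ (totalDegree_equivMvPolynomial_le hP))

end Trivial

end Literature.NumberTheory.DiophantineGeometry.PlaneShear
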